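import Summits.BirchSwinnertonDyer.BirchSwinnertonDyer.Theorems.ManinLocalTwoThreeCDivisionIndexFourRationalTwoTorsion
import Summits.BirchSwinnertonDyer.BirchSwinnertonDyer.Theorems.ManinLocalTwoThreeFreyTwistShapeConductorAtTwo
import HarnessLib

/-!
# C2 `ManinOddAtFour` ⟸ CDT ∧ E-es-185♭ — the Kummer–diamond line WITHOUT F★ / CES
(route `ManinLocalTwoThree`, crux C2 `ManinOddAtFour` stmt-BirchSwinnertonDyer-22967; cell bsd-f2-manin, prover p3 gen 19)

The line of record `kummer_diamond` (LEAD p1 g19/g20) closes C2 from the printed CDT theorem and the law E-es-185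
`KummerDiamond.IndexFourForcesFreyTwistShape` (index `4` ⟹ `2⁵ ∣ N` ∧ Frey-twist shape), whose port consumes E-an-152d (full rational
`2`-torsion in the index-`4` world) — so far a theorem only modulo F★ (Stevens' cusp rationality) and CES (optimal `X₁`-datum).  Since
`CDivTranslate.exists_three_hasRationalTwoTorsionX_of_indexFour` (p3 g19) proves E-an-152d in the kernel whenever `|c₀| = 2` — which the
composition has (CDT: `c₀ ∣ 2`; C2's negated goal: `2 ∣ c₀`) — the law the line needs is only the FLAT form **E-es-185♭**: the same conclusion for
index-`4` data that are GIVEN `|c₀| = 2` and three rational `2`-torsion abscissae.  It is stated here as an explicit binder (no definition):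
* `maninOddAtFour_of_CDTInt_shape185Flat` — `CDT (Thm 1.0.1 as printed) → E-es-185♭ → ManinOddAtFour` (E-es-186♭ = Tate family C at `2` is the
  landed theorem `FreyTwistConductor.freyTwistShapeTwoAdicLaw_holds_of_modularity`; modularity is C2's own fourth binder);
* `shape185Flat_of_shape185` — E-es-185 ⟹ E-es-185♭ (so nothing is lost);
* `maninConstantOne_of_printedFacts_CDTInt_shape185Flat` — the whole route through `closes`.
HONEST FRAMING: CONDITIONAL on the printed CDT theorem (statement-only) and on E-es-185♭ (OPEN; paper-proved per MEMO-es §59 / ref1 §R215); C2, Manin's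
conjecture and BSD are NOT proved here.  No definitions, no sorry. [cite: CalegariDimitrovTang2025, Thm. 1.0.1] [cite: Stevens1989, §2]
[cite: LingOesterle1991, Thm. 6]
-/

set_option autoImplicit false
-- lint-debt: the directory name repeats the summit name (sibling precedent `ManinLocalTwoThreeCDivisionGaloisEngine.lean`)
set_option linter.dupNamespace false

noncomputable section

open scoped Topology PeriodPair MatrixGroups ModularForm Manifold Classical
open Complex Filter PowerSeries CongruenceSubgroup
open UpperHalfPlane hiding I
open WeierstrassCurve Literature.NumberTheory.EllipticCurves Literature.NumberTheory.EllipticCurves.ModularForms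
open Summit.BirchSwinnertonDyer.Rank1Residual.ManinAdditive.KummerDiamond

namespace Summit.BirchSwinnertonDyer.BirchSwinnertonDyer.Theorems.ManinLocalTwoThree.CDivTranslate

/-- **E-es-185 ⟹ E-es-185♭** (the flat form only adds hypotheses). -/
theorem shape185Flat_of_shape185 (h185 : IndexFourForcesFreyTwistShape) :
    ∀ (W₀ : WeierstrassCurve ℚ) [W₀.IsElliptic] [W₀.IsGloballyMinimal] {N : ℕ} [NeZero N] (D₀ : ModularParametrizationData W₀ N),
      (∀ z ∈ D₀.L.lattice, ∃ w ∈ periodLattice D₀.f, z = D₀.c * w) → D₀.c.natAbs = 2 →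
      (∀ z : ℂ, z ∈ periodLatticeGamma1 D₀.f ↔ ∃ w ∈ periodLattice D₀.f, z = 2 * w) →
      (∃ x₁ x₂ x₃ : ℚ, x₁ ≠ x₂ ∧ x₁ ≠ x₃ ∧ x₂ ≠ x₃ ∧
        Literature.NumberTheory.EllipticCurves.Greenberg1999.HasRationalTwoTorsionX W₀ x₁ ∧
        Literature.NumberTheory.EllipticCurves.Greenberg1999.HasRationalTwoTorsionX W₀ x₂ ∧
        Literature.NumberTheory.EllipticCurves.Greenberg1999.HasRationalTwoTorsionX W₀ x₃) →
      2 ^ 5 ∣ N ∧ HasFreyTwistShape W₀ :=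
  fun W₀ _ _ _ _ D₀ hopt _ hidx _ ↦ h185 W₀ D₀ hopt hidx

/-- **C2 `ManinOddAtFour` ⟸ CDT THEOREM 1.0.1 (as printed) ∧ E-es-185♭.**  On the odd-square locus `|c₀| = 1` (`CDivisionInt`); else `2 ∣ c₀` gives
`Λ₁(f) = 2Λ₀(f)` and `|c₀| = 2`, hence three rational `2`-torsion abscissae (`exists_three_hasRationalTwoTorsionX_of_indexFour`, kernel theorem, p3 g19),
hence by E-es-185♭ `2⁵ ∣ N` and the Frey-twist shape, contradicting E-es-186♭ (Tate family C: conductor exponent `4` at `2`; landed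
`FreyTwistConductor.freyTwistShapeTwoAdicLaw_holds_of_modularity`, modularity being C2's fourth binder).  CONDITIONAL; C2, Manin's conjecture and
BSD are not proved by this. [cite: CalegariDimitrovTang2025, Thm. 1.0.1] [cite: Stevens1989, §2] [cite: LingOesterle1991, Thm. 6] -/
theorem maninOddAtFour_of_CDTInt_shape185Flat
    (hCDT : Literature.NumberTheory.Automorphic.CalegariDimitrovTang2025_unboundedDenominators)
    (h185 : ∀ (W₀ : WeierstrassCurve ℚ) [W₀.IsElliptic] [W₀.IsGloballyMinimal] {N : ℕ} [NeZero N] (D₀ : ModularParametrizationData W₀ N),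
      (∀ z ∈ D₀.L.lattice, ∃ w ∈ periodLattice D₀.f, z = D₀.c * w) → D₀.c.natAbs = 2 →
      (∀ z : ℂ, z ∈ periodLatticeGamma1 D₀.f ↔ ∃ w ∈ periodLattice D₀.f, z = 2 * w) →
      (∃ x₁ x₂ x₃ : ℚ, x₁ ≠ x₂ ∧ x₁ ≠ x₃ ∧ x₂ ≠ x₃ ∧
        Literature.NumberTheory.EllipticCurves.Greenberg1999.HasRationalTwoTorsionX W₀ x₁ ∧
        Literature.NumberTheory.EllipticCurves.Greenberg1999.HasRationalTwoTorsionX W₀ x₂ ∧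
        Literature.NumberTheory.EllipticCurves.Greenberg1999.HasRationalTwoTorsionX W₀ x₃) →
      2 ^ 5 ∣ N ∧ HasFreyTwistShape W₀) :
    Summit.BirchSwinnertonDyer.BirchSwinnertonDyer.Theses.ManinLocalTwoThree.ManinOddAtFour := by
  intro _hM _hAU _hC hnf W _ _ N _ D hopt h4
  have hSI := CDivisionInt.periodLatticeGamma1_le_neron_of_CDTInt hCDT D
  by_cases hsq : ∃ p : ℕ, p.Prime ∧ 3 ≤ p ∧ p ^ 2 ∣ N
  · obtain ⟨p, hp, h3, hpN⟩ := hsq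
    exact CDivisionNeron.not_prime_dvd_of_abs_eq_one
      (CDivisionInt.abs_maninConstant_eq_one_of_CDTInt_of_odd_sq_dvd hCDT D hopt hp h3 hpN) Nat.prime_two
  · intro h2c
    have hidx := CDivisionNeron.indexFour_of_gamma1Periods_le_of_four_dvd_of_two_dvd D hopt hSI h4 h2c
    have hdvd2 : D.maninConstant ∣ 2 := CDivisionInt.maninConstant_dvd_two_of_CDTInt_of_four_dvd hCDT D hopt h4
    have hc0 : D.c ≠ 0 := D.maninConstant_ne_zero_holds
    have hc2 : D.c.natAbs = 2 := by
      have hle : D.c.natAbs ≤ 2 :=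
        Nat.le_of_dvd two_pos (by simpa [ModularParametrizationData.maninConstant] using Int.natAbs_dvd_natAbs.mpr hdvd2)
      have hdvd : 2 ∣ D.c.natAbs := by
        simpa [ModularParametrizationData.maninConstant] using Int.natAbs_dvd_natAbs.mpr h2c
      have hne : D.c.natAbs ≠ 0 := Int.natAbs_ne_zero.mpr hc0
      omega
    have htors := exists_three_hasRationalTwoTorsionX_of_indexFour D hopt hc2 hidx
    obtain ⟨h32, hshape⟩ := h185 W D hopt hc2 hidx htors
    exact FreyTwistConductor.freyTwistShapeTwoAdicLaw_holds_of_modularity hnf W D hshape h32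

/-- **THE WHOLE ROUTE: `ManinConstantOne` ⟸ PrintedSemistableManinFacts ∧ CDT Theorem 1.0.1 ∧ E-es-185♭** (through the route's `closes`; C3 and the residual
C5 from p2's `CDivisionInt` chain).  CONDITIONAL architecture; MANIN'S CONJECTURE AND BSD ARE NOT PROVED BY THIS. [cite: CalegariDimitrovTang2025, Thm. 1.0.1]
[cite: Cesnavicius2018, Thm. 1.2] [cite: Stevens1989, §2] -/
theorem maninConstantOne_of_printedFacts_CDTInt_shape185Flat
    (hPF : Summit.BirchSwinnertonDyer.BirchSwinnertonDyer.Theses.ManinLocalTwoThree.PrintedSemistableManinFacts)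
    (hCDT : Literature.NumberTheory.Automorphic.CalegariDimitrovTang2025_unboundedDenominators)
    (h185 : ∀ (W₀ : WeierstrassCurve ℚ) [W₀.IsElliptic] [W₀.IsGloballyMinimal] {N : ℕ} [NeZero N] (D₀ : ModularParametrizationData W₀ N),
      (∀ z ∈ D₀.L.lattice, ∃ w ∈ periodLattice D₀.f, z = D₀.c * w) → D₀.c.natAbs = 2 →
      (∀ z : ℂ, z ∈ periodLatticeGamma1 D₀.f ↔ ∃ w ∈ periodLattice D₀.f, z = 2 * w) →
      (∃ x₁ x₂ x₃ : ℚ, x₁ ≠ x₂ ∧ x₁ ≠ x₃ ∧ x₂ ≠ x₃ ∧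
        Literature.NumberTheory.EllipticCurves.Greenberg1999.HasRationalTwoTorsionX W₀ x₁ ∧
        Literature.NumberTheory.EllipticCurves.Greenberg1999.HasRationalTwoTorsionX W₀ x₂ ∧
        Literature.NumberTheory.EllipticCurves.Greenberg1999.HasRationalTwoTorsionX W₀ x₃) →
      2 ^ 5 ∣ N ∧ HasFreyTwistShape W₀) :
    Summit.BirchSwinnertonDyer.Rank1Residual.ManinConstant.ManinConstantOne :=
  Summit.BirchSwinnertonDyer.BirchSwinnertonDyer.Theses.ManinLocalTwoThree.closes hPF
    (maninOddAtFour_of_CDTInt_shape185Flat hCDT h185)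
    (CDivisionInt.maninPrimeToThreeAtNine_of_CDTInt hCDT)
    (CDivisionInt.maninPrimeToAdditiveFiveLe_of_CDTInt hCDT)
    maninLocalTwoThree_assembly_proof

end Summit.BirchSwinnertonDyer.BirchSwinnertonDyer.Theorems.ManinLocalTwoThree.CDivTranslate

end
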